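import Literature.Geometry.Lorentzian.KerrSchildChartCovariance
import Literature.Geometry.Lorentzian.WeylScalarPhaseWindow
import Literature.Geometry.Lorentzian.CoordRicciCovariance
import Literature.Geometry.Lorentzian.CoordRicciPerturbation

/-!
# Phase rigidity of the Weyl scalar — registered stub `stub_phaseRigidity` (crux `TameCensorship`, line `crush-the-swallowed-interior`)
Corrected form with two leading hypotheses, the published closed forms of two polynomial curvature invariants of Kerr in Kerr–Schild
coordinates (type D, `Ψ₂ = −M/(r − ia cos θ)³`): `hQ` Kretschmann `|Rm|² = 48M² Re(r + ia cos θ)⁶/Σ⁶`, `hT` cubic trace invariant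
`= 48M³ Re(r + ia cos θ)⁹/Σ⁹` in every frame. Along the pushed Killing orbit of the boosted polar near-horizon point `x₀` the two trace
invariants of `Ψ^* g` converge to the extremal values `(−48 Re t², 48 Re t³)`, `t = M'/(r' − ia')³` (`KerrSchildChart.tendsto_dev_jets_orbit`,
`MetricCoord.tendsto_quadTrace_of_jets`, naturality `quadTrace_pullMetric`), while inside `E ∩ {r ≥ r₊}` they equal `(−48 Re z², 48 Re z³)`,
`z = M/(r − ia cos θ)³` sub-extremal, `ε`-far from `t` and `conj t` (`WeylPhase.false_of_tendsto_re_sq_re_cube`): contradiction.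
-/

noncomputable section
set_option linter.dupNamespace false
set_option maxSynthPendingDepth 3
open scoped Manifold ContDiff Topology ENNReal NNReal
open Set Filter Function TopologicalSpace
open Literature.Geometry.Lorentzian

namespace Summit.FinalStateConjecture.FinalStateConjecture.Theorems.PhotonSphereChannels.TameCensorshipCrush

section Values

open ContinuousLinearMap Complex Literature.Geometry.Lorentzian.MetricCoord
open Literature.Geometry.Lorentzian.KerrSchildChart Literature.Geometry.Lorentzian.WeylPhase

universe u

variable {𝓢 : Spacetime.{u} 4} {U : Opens E4} {Ψ : U → 𝓢.carrier}
  (hΨ : ContMDiff 𝓘(ℝ, E4) (𝓡 4) ∞ Ψ) {Gp : E4 → E4 →L[ℝ] E4 →L[ℝ] ℝ}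
  (hGp : ∀ y : U, pullbackBilin (I := 𝓡 4) (I' := 𝓘(ℝ, E4)) Ψ 𝓢.metric.val y = Gp y)
  {a₀ r₀ : ℝ} {E : Set 𝓢.carrier} {χ : 𝓢.carrier → Kerr.region a₀ r₀} (hE : IsOpen E)
  (hχ : ContMDiffOn (𝓡 4) (𝓡 4) ∞ χ E) [Kerr.Facts] {M₀ : ℝ} {hM₀ : 0 ≤ M₀}
  (hpull : ∀ p ∈ E, pullbackBilin (I := 𝓡 4) (I' := 𝓡 4)
    (M := (Kerr.spacetime M₀ a₀ r₀ hM₀).carrier) χ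
    (Kerr.spacetime M₀ a₀ r₀ hM₀).metric.val p = 𝓢.metric.val p)

omit [Kerr.Facts] in
/-- Algebra: `48 M² Re w⁶/Σ⁶ = 48 Re z²` and `48 M³ Re w⁹/Σ⁹ = 48 Re z³` at a point with `r > 0`.
[folklore] -/
theorem kerr_values_eq (M a : ℝ) {x : E4} (hx : 0 < Kerr.radius a x) :
    48 * M ^ 2 * (((Kerr.radius a x : ℂ) +
          ((a * (x 3 / Kerr.radius a x) : ℝ) : ℂ) * Complex.I) ^ 6).re /
          (Kerr.radius a x ^ 2 + (a * (x 3 / Kerr.radius a x)) ^ 2) ^ 6 =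
      48 * (((M : ℂ) / ((Kerr.radius a x : ℂ) -
        ((a * (x 3 / Kerr.radius a x) : ℝ) : ℂ) * Complex.I) ^ 3) ^ 2).re ∧
    48 * M ^ 3 * (((Kerr.radius a x : ℂ) +
          ((a * (x 3 / Kerr.radius a x) : ℝ) : ℂ) * Complex.I) ^ 9).re /
          (Kerr.radius a x ^ 2 + (a * (x 3 / Kerr.radius a x)) ^ 2) ^ 9 =
      48 * (((M : ℂ) / ((Kerr.radius a x : ℂ) -
        ((a * (x 3 / Kerr.radius a x) : ℝ) : ℂ) * Complex.I) ^ 3) ^ 3).re := by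
  have h : 0 < Kerr.radius a x ^ 2 + (a * (x 3 / Kerr.radius a x)) ^ 2 := by positivity
  obtain ⟨h2, h3⟩ := re_sq_re_cube_div_cube M (Kerr.radius a x) (a * (x 3 / Kerr.radius a x)) h
  constructor
  · rw [← h2]; ring
  · rw [← h3]; ring

include hΨ hGp hE hχ hpull in
/-- **The two invariants of `Ψ^* g` at a good point are those of exact Kerr `(M, a)` at the image
point**: by locality and naturality (`quadTrace_pullMetric`, `cubicTrace_pullMetric` along the
composite chart) and the closed forms `hQ`, `hT`, with `z = M/(r − i a cos θ)³` at `χ(Ψ y)`: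
`Σ g g tr(RR) = −48 Re z²` and `Σ g g g tr(RRR) = 48 Re z³`. [folklore] -/
theorem invariants_at_goodSet (hQ : (∀ (M a : ℝ) (x : E4), 0 < Kerr.radius a x →
      MetricCoord.rmNormSqAt (Kerr.bilin M a) x =
        48 * M ^ 2 * (((Kerr.radius a x : ℂ) +
          ((a * (x 3 / Kerr.radius a x) : ℝ) : ℂ) * Complex.I) ^ 6).re /
          (Kerr.radius a x ^ 2 + (a * (x 3 / Kerr.radius a x)) ^ 2) ^ 6))
    (hT : (∀ (M a : ℝ) (x : E4), 0 < Kerr.radius a x → ∀ (b : Module.Basis (Fin 4) ℝ E4),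
      ∑ i, ∑ i', ∑ j, ∑ j', ∑ k, ∑ k',
        MetricCoord.ginv (Kerr.bilin M a) b x i i' * MetricCoord.ginv (Kerr.bilin M a) b x j j' *
        MetricCoord.ginv (Kerr.bilin M a) b x k k' *
        MetricCoord.traceCLM E4 ((MetricCoord.riemAt (Kerr.bilin M a) x (b i) (b j)).comp
          ((MetricCoord.riemAt (Kerr.bilin M a) x (b j') (b k)).comp
            (MetricCoord.riemAt (Kerr.bilin M a) x (b k') (b i')))) =
        48 * M ^ 3 * (((Kerr.radius a x : ℂ) +
          ((a * (x 3 / Kerr.radius a x) : ℝ) : ℂ) * Complex.I) ^ 9).re /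
          (Kerr.radius a x ^ 2 + (a * (x 3 / Kerr.radius a x)) ^ 2) ^ 9))
    {z : E4} (hz : z ∈ {z : E4 | ∃ h : z ∈ U, Ψ ⟨z, h⟩ ∈ E ∧ (Gp z).IsInvertible}) :
    (∑ i, ∑ i', ∑ j, ∑ j', MetricCoord.ginv Gp (EuclideanSpace.basisFun (Fin 4) ℝ).toBasis z i i' * MetricCoord.ginv Gp (EuclideanSpace.basisFun (Fin 4) ℝ).toBasis z j j' *
          MetricCoord.traceCLM E4 ((MetricCoord.riemAt Gp z ((EuclideanSpace.basisFun (Fin 4) ℝ).toBasis i) ((EuclideanSpace.basisFun (Fin 4) ℝ).toBasis j)).comp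
            (MetricCoord.riemAt Gp z ((EuclideanSpace.basisFun (Fin 4) ℝ).toBasis i') ((EuclideanSpace.basisFun (Fin 4) ℝ).toBasis j')))) =
      -48 * (((M₀ : ℂ) / ((Kerr.radius a₀ (χ (Ψ ⟨z, hz.1⟩)).1 : ℂ) -
        ((a₀ * ((χ (Ψ ⟨z, hz.1⟩)).1 3 / Kerr.radius a₀ (χ (Ψ ⟨z, hz.1⟩)).1) : ℝ) : ℂ) *
          Complex.I) ^ 3) ^ 2).re ∧
    (∑ i, ∑ i', ∑ j, ∑ j', ∑ k, ∑ k',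
          MetricCoord.ginv Gp (EuclideanSpace.basisFun (Fin 4) ℝ).toBasis z i i' * MetricCoord.ginv Gp (EuclideanSpace.basisFun (Fin 4) ℝ).toBasis z j j' *
          MetricCoord.ginv Gp (EuclideanSpace.basisFun (Fin 4) ℝ).toBasis z k k' *
          MetricCoord.traceCLM E4 ((MetricCoord.riemAt Gp z ((EuclideanSpace.basisFun (Fin 4) ℝ).toBasis i) ((EuclideanSpace.basisFun (Fin 4) ℝ).toBasis j)).comp
            ((MetricCoord.riemAt Gp z ((EuclideanSpace.basisFun (Fin 4) ℝ).toBasis j') ((EuclideanSpace.basisFun (Fin 4) ℝ).toBasis k)).comp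
              (MetricCoord.riemAt Gp z ((EuclideanSpace.basisFun (Fin 4) ℝ).toBasis k') ((EuclideanSpace.basisFun (Fin 4) ℝ).toBasis i'))))) =
      48 * (((M₀ : ℂ) / ((Kerr.radius a₀ (χ (Ψ ⟨z, hz.1⟩)).1 : ℂ) -
        ((a₀ * ((χ (Ψ ⟨z, hz.1⟩)).1 3 / Kerr.radius a₀ (χ (Ψ ⟨z, hz.1⟩)).1) : ℝ) : ℂ) *
          Complex.I) ^ 3) ^ 3).re := by
  set e := (EuclideanSpace.basisFun (Fin 4) ℝ).toBasis with he
  set W := {z : E4 | ∃ h : z ∈ U, Ψ ⟨z, h⟩ ∈ E ∧ (Gp z).IsInvertible} with hW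
  set F := Function.extend Subtype.val (fun y : U ↦ ((χ (Ψ y)).1 : E4)) 0 with hF
  have hWo : IsOpen W := isOpen_goodSet hΨ hGp hE
  have hFc : IsCoordChangeOn F W (Kerr.region a₀ r₀ : Set E4) :=
    isCoordChangeOn_compChart hΨ hGp hE hχ hpull
  have hK : IsMetricOn (Kerr.bilin M₀ a₀) (Kerr.region a₀ r₀ : Set E4) := isMetricOn_kerrBilin M₀ a₀ r₀
  obtain ⟨D, hD⟩ := hFc.isInvertible z hz
  have hFz : F z = (χ (Ψ ⟨z, hz.1⟩)).1 := compChart_apply (χ := χ) (Ψ := Ψ) ⟨z, hz.1⟩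
  have hreg : F z ∈ (Kerr.region a₀ r₀ : Set E4) := hFc.mapsTo hz
  have hr : 0 < Kerr.radius a₀ (F z) := Kerr.radius_pos_of_mem_region hreg
  have hloc : ∀ y ∈ W, Gp y = pullMetric (Kerr.bilin M₀ a₀) F y := fun y hy ↦
    chartMetric_eq_pullMetric hΨ hGp hE hχ hpull (y := ⟨y, hy.1⟩) hy.2.1
  have hR : ∀ X Y, riemAt Gp z X Y = riemAt (pullMetric (Kerr.bilin M₀ a₀) F) z X Y := fun X Y ↦ by
    rw [riemAt_congr_of_eqOn hWo hloc hz]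
  have hg : ∀ i j, ginv Gp e z i j = ginv (pullMetric (Kerr.bilin M₀ a₀) F) e z i j := fun i j ↦ by
    unfold ginv sharpAt
    rw [hloc z hz]
  obtain ⟨v2, v3⟩ := kerr_values_eq M₀ a₀ hr
  constructor
  · have hnat := quadTrace_pullMetric e hK hFc hz hD
    have hsum := rmNormSqAt_eq_sum (G := Kerr.bilin M₀ a₀) (x := F z) (e.map D.toLinearEquiv)
    simp only [hg, hR]
    rw [hnat, ← neg_eq_iff_eq_neg.mpr hsum, hQ M₀ a₀ (F z) hr, v2, hFz]
    ring
  · have hnat := cubicTrace_pullMetric e hK hFc hz hD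
    simp only [hg, hR]
    rw [hnat, hT M₀ a₀ (F z) hr (e.map D.toLinearEquiv), v3, hFz]

end Values

section Target

open ContinuousLinearMap Complex Literature.Geometry.Lorentzian.MetricCoord
open Literature.Geometry.Lorentzian.KerrSchildChart Literature.Geometry.Lorentzian.WeylPhase

variable (Λ : lorentzGroup) (c : E4)

/-- **The two invariants of the boosted extremal background at the boosted polar point** `x₀ =
Λ(0,0,0,r') + c`: those of exact Kerr `(M', a')` at `(0,0,0,r')` (naturality along the affine
Poincaré map), i.e. `−48 Re t²` and `48 Re t³` with `t = M'/(r' − i a')³`. [folklore] -/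
theorem invariants_at_target (hQ : (∀ (M a : ℝ) (x : E4), 0 < Kerr.radius a x →
      MetricCoord.rmNormSqAt (Kerr.bilin M a) x =
        48 * M ^ 2 * (((Kerr.radius a x : ℂ) +
          ((a * (x 3 / Kerr.radius a x) : ℝ) : ℂ) * Complex.I) ^ 6).re /
          (Kerr.radius a x ^ 2 + (a * (x 3 / Kerr.radius a x)) ^ 2) ^ 6))
    (hT : (∀ (M a : ℝ) (x : E4), 0 < Kerr.radius a x → ∀ (b : Module.Basis (Fin 4) ℝ E4),
      ∑ i, ∑ i', ∑ j, ∑ j', ∑ k, ∑ k',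
        MetricCoord.ginv (Kerr.bilin M a) b x i i' * MetricCoord.ginv (Kerr.bilin M a) b x j j' *
        MetricCoord.ginv (Kerr.bilin M a) b x k k' *
        MetricCoord.traceCLM E4 ((MetricCoord.riemAt (Kerr.bilin M a) x (b i) (b j)).comp
          ((MetricCoord.riemAt (Kerr.bilin M a) x (b j') (b k)).comp
            (MetricCoord.riemAt (Kerr.bilin M a) x (b k') (b i')))) =
        48 * M ^ 3 * (((Kerr.radius a x : ℂ) +
          ((a * (x 3 / Kerr.radius a x) : ℝ) : ℂ) * Complex.I) ^ 9).re /
          (Kerr.radius a x ^ 2 + (a * (x 3 / Kerr.radius a x)) ^ 2) ^ 9))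
    {M' a' r' : ℝ} (hext : Kerr.IsExtremal M' a') (hr' : M' < r') :
    (∑ i, ∑ i', ∑ j, ∑ j', MetricCoord.ginv (boostedKerrBilin Λ c M' a') (EuclideanSpace.basisFun (Fin 4) ℝ).toBasis ((Λ : E4 ≃L[ℝ] E4) (r' • E4.basisVector 3) + c) i i' * MetricCoord.ginv (boostedKerrBilin Λ c M' a') (EuclideanSpace.basisFun (Fin 4) ℝ).toBasis ((Λ : E4 ≃L[ℝ] E4) (r' • E4.basisVector 3) + c) j j' *
          MetricCoord.traceCLM E4 ((MetricCoord.riemAt (boostedKerrBilin Λ c M' a') ((Λ : E4 ≃L[ℝ] E4) (r' • E4.basisVector 3) + c) ((EuclideanSpace.basisFun (Fin 4) ℝ).toBasis i) ((EuclideanSpace.basisFun (Fin 4) ℝ).toBasis j)).comp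
            (MetricCoord.riemAt (boostedKerrBilin Λ c M' a') ((Λ : E4 ≃L[ℝ] E4) (r' • E4.basisVector 3) + c) ((EuclideanSpace.basisFun (Fin 4) ℝ).toBasis i') ((EuclideanSpace.basisFun (Fin 4) ℝ).toBasis j')))) =
      -48 * (((M' : ℂ) / ((r' : ℂ) - (a' : ℂ) * Complex.I) ^ 3) ^ 2).re ∧
    (∑ i, ∑ i', ∑ j, ∑ j', ∑ k, ∑ k',
          MetricCoord.ginv (boostedKerrBilin Λ c M' a') (EuclideanSpace.basisFun (Fin 4) ℝ).toBasis ((Λ : E4 ≃L[ℝ] E4) (r' • E4.basisVector 3) + c) i i' * MetricCoord.ginv (boostedKerrBilin Λ c M' a') (EuclideanSpace.basisFun (Fin 4) ℝ).toBasis ((Λ : E4 ≃L[ℝ] E4) (r' • E4.basisVector 3) + c) j j' *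
          MetricCoord.ginv (boostedKerrBilin Λ c M' a') (EuclideanSpace.basisFun (Fin 4) ℝ).toBasis ((Λ : E4 ≃L[ℝ] E4) (r' • E4.basisVector 3) + c) k k' *
          MetricCoord.traceCLM E4 ((MetricCoord.riemAt (boostedKerrBilin Λ c M' a') ((Λ : E4 ≃L[ℝ] E4) (r' • E4.basisVector 3) + c) ((EuclideanSpace.basisFun (Fin 4) ℝ).toBasis i) ((EuclideanSpace.basisFun (Fin 4) ℝ).toBasis j)).comp
            ((MetricCoord.riemAt (boostedKerrBilin Λ c M' a') ((Λ : E4 ≃L[ℝ] E4) (r' • E4.basisVector 3) + c) ((EuclideanSpace.basisFun (Fin 4) ℝ).toBasis j') ((EuclideanSpace.basisFun (Fin 4) ℝ).toBasis k)).comp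
              (MetricCoord.riemAt (boostedKerrBilin Λ c M' a') ((Λ : E4 ≃L[ℝ] E4) (r' • E4.basisVector 3) + c) ((EuclideanSpace.basisFun (Fin 4) ℝ).toBasis k') ((EuclideanSpace.basisFun (Fin 4) ℝ).toBasis i'))))) =
      48 * (((M' : ℂ) / ((r' : ℂ) - (a' : ℂ) * Complex.I) ^ 3) ^ 3).re := by
  set e := (EuclideanSpace.basisFun (Fin 4) ℝ).toBasis with he
  set x₀ : E4 := (Λ : E4 ≃L[ℝ] E4) (r' • E4.basisVector 3) + c with hx₀def
  have hx₀ : x₀ ∈ (boostedKerrExterior Λ c M' a' : Set E4) := boostedPolar_mem_domain Λ c hext hr'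
  have hK : IsMetricOn (Kerr.bilin M' a') (Kerr.exterior M' a' : Set E4) :=
    isMetricOn_kerrBilin M' a' (Kerr.rPlus M' a')
  have hP := isCoordChangeOn_poincareInv Λ c M' a'
  have hD : (((Λ : E4 ≃L[ℝ] E4).symm : E4 ≃L[ℝ] E4) : E4 →L[ℝ] E4) = fderiv ℝ (poincareInv Λ c) x₀ :=
    (fderiv_poincareInv Λ c x₀).symm
  have hPx : poincareInv Λ c x₀ = r' • E4.basisVector 3 := poincareInv_boostedPolar Λ c r'
  have hr0 : 0 < r' := hext.2.trans hr'
  have hrad : Kerr.radius a' (r' • E4.basisVector 3) = r' := radius_polar a' hr0.le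
  have hp3 : (r' • E4.basisVector 3 : E4) 3 = r' := by simp
  have hμ : a' * ((r' • E4.basisVector 3 : E4) 3 / Kerr.radius a' (r' • E4.basisVector 3)) = a' := by
    rw [hp3, hrad, div_self hr0.ne', mul_one]
  have hrp : 0 < Kerr.radius a' (r' • E4.basisVector 3) := by rw [hrad]; exact hr0
  obtain ⟨v2, v3⟩ := kerr_values_eq M' a' (x := r' • E4.basisVector 3) hrp
  rw [hμ, hrad] at v2 v3
  rw [boostedKerrBilin_eq_pullMetric]
  constructor
  · have hnat := quadTrace_pullMetric e hK hP hx₀ hD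
    have hsum := rmNormSqAt_eq_sum (G := Kerr.bilin M' a') (x := poincareInv Λ c x₀)
      (e.map ((Λ : E4 ≃L[ℝ] E4).symm).toLinearEquiv)
    rw [hnat, ← neg_eq_iff_eq_neg.mpr hsum, hPx, hQ M' a' _ hrp, hμ, hrad, v2]
    ring
  · have hnat := cubicTrace_pullMetric e hK hP hx₀ hD
    rw [hnat, hPx, hT M' a' _ hrp, hμ, hrad, v3]

end Target

section Main

open ContinuousLinearMap Complex Literature.Geometry.Lorentzian.MetricCoord
open Literature.Geometry.Lorentzian.KerrSchildChart Literature.Geometry.Lorentzian.WeylPhase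

set_option maxHeartbeats 3200000 in
set_option synthInstance.maxHeartbeats 400000 in
/-- Phase rigidity from the closed forms `hQ`, `hT` (see the module docstring). [folklore] -/
theorem stub_phaseRigidity_main :
    (∀ (M a : ℝ) (x : E4), 0 < Kerr.radius a x →
      MetricCoord.rmNormSqAt (Kerr.bilin M a) x =
        48 * M ^ 2 * (((Kerr.radius a x : ℂ) +
          ((a * (x 3 / Kerr.radius a x) : ℝ) : ℂ) * Complex.I) ^ 6).re /
          (Kerr.radius a x ^ 2 + (a * (x 3 / Kerr.radius a x)) ^ 2) ^ 6) →
    (∀ (M a : ℝ) (x : E4), 0 < Kerr.radius a x → ∀ (b : Module.Basis (Fin 4) ℝ E4),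
      ∑ i, ∑ i', ∑ j, ∑ j', ∑ k, ∑ k',
        MetricCoord.ginv (Kerr.bilin M a) b x i i' * MetricCoord.ginv (Kerr.bilin M a) b x j j' *
        MetricCoord.ginv (Kerr.bilin M a) b x k k' *
        MetricCoord.traceCLM E4 ((MetricCoord.riemAt (Kerr.bilin M a) x (b i) (b j)).comp
          ((MetricCoord.riemAt (Kerr.bilin M a) x (b j') (b k)).comp
            (MetricCoord.riemAt (Kerr.bilin M a) x (b k') (b i')))) =
        48 * M ^ 3 * (((Kerr.radius a x : ℂ) +
          ((a * (x 3 / Kerr.radius a x) : ℝ) : ℂ) * Complex.I) ^ 9).re /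
          (Kerr.radius a x ^ 2 + (a * (x 3 / Kerr.radius a x)) ^ 2) ^ 9) →
    ∀ [Kerr.Facts] (𝓢 : Spacetime.{0} 4) (M a : ℝ) (hM : 0 ≤ M), |a| < M →
    ∀ (E : Set 𝓢.carrier) (χ : 𝓢.carrier → (Kerr.spacetime M a (Kerr.rMinus M a) hM).carrier),
      IsOpen E → ContMDiffOn (𝓡 4) (𝓡 4) ∞ χ E →
      (∀ p ∈ E, pullbackBilin (I := 𝓡 4) (I' := 𝓡 4) χ
        (Kerr.spacetime M a (Kerr.rMinus M a) hM).metric.val p = 𝓢.metric.val p) →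
    ∀ (Λ : lorentzGroup) (c : E4) (M' a' : ℝ), Kerr.IsExtremal M' a' →
    ∀ (τ₀ : ℝ) (Ψ : (boostedKerrBackground Λ c M' a').domain → 𝓢.carrier),
      𝓢.IsLateChart (boostedKerrBackground Λ c M' a') Set.univ τ₀ Ψ →
      (∀ R : ℝ, Tendsto (fun τ => 𝓢.truncDeviationCk
        (boostedKerrBackground Λ c M' a') Ψ 2 R τ) atTop (𝓝 0)) →
      ∃ x₀ : (boostedKerrBackground Λ c M' a').domain,
        (boostedKerrBackground Λ c M' a').bilin x₀.1
            ((Λ : E4 ≃L[ℝ] E4) (EuclideanSpace.single (0 : Fin 4) (1 : ℝ)))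
            ((Λ : E4 ≃L[ℝ] E4) (EuclideanSpace.single (0 : Fin 4) (1 : ℝ))) < 0 ∧
        ∀ (γ : ℝ → 𝓢.carrier)
          (hdom : ∀ s : ℝ, (x₀ : E4) + s • (Λ : E4 ≃L[ℝ] E4) (EuclideanSpace.single (0 : Fin 4) (1 : ℝ)) ∈
            (boostedKerrBackground Λ c M' a').domain),
          (∀ s : ℝ, γ s = Ψ ⟨(x₀ : E4) + s • (Λ : E4 ≃L[ℝ] E4) (EuclideanSpace.single (0 : Fin 4) (1 : ℝ)),
            hdom s⟩) →
          ¬ ∃ s₀ : ℝ, ∀ s : ℝ, s₀ ≤ s →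
              γ s ∈ E ∧ Kerr.rPlus M a ≤ Kerr.radius a (χ (γ s)).1 := by
  intro hQ hT _inst 𝓢 M a hM ha E χ hEo hχ hpull Λ c M' a' hext τ₀ Ψ hΨ hdev
  obtain ⟨r', hr', -, hre, ε, hε, hsep⟩ := psi2_separation ha hext
  have hx₀ : (Λ : E4 ≃L[ℝ] E4) (r' • E4.basisVector 3) + c ∈ (boostedKerrBackground Λ c M' a').domain :=
    boostedPolar_mem_domain Λ c hext hr'
  refine ⟨⟨(Λ : E4 ≃L[ℝ] E4) (r' • E4.basisVector 3) + c, hx₀⟩, boostedPolar_bilin_neg Λ c hext hr', ?_⟩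
  intro γ hdom hγ
  rintro ⟨s₀, hs₀⟩
  set x₀ : E4 := (Λ : E4 ≃L[ℝ] E4) (r' • E4.basisVector 3) + c with hx₀def
  set v₀ : E4 := (Λ : E4 ≃L[ℝ] E4) (EuclideanSpace.single (0 : Fin 4) (1 : ℝ)) with hv₀
  set Gp : E4 → E4 →L[ℝ] E4 →L[ℝ] ℝ := fun z ↦
    𝓢.deviationExtend (boostedKerrBackground Λ c M' a') Ψ z + boostedKerrBilin Λ c M' a' z with hGpdef
  have hGp : ∀ y : (boostedKerrBackground Λ c M' a').domain,
      pullbackBilin (I := 𝓡 4) (I' := 𝓘(ℝ, E4)) Ψ 𝓢.metric.val y = Gp y :=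
    chartMetric_repr Λ c M' a' Ψ
  have hΨc : ContMDiff 𝓘(ℝ, E4) (𝓡 4) ∞ Ψ := hΨ.contMDiff
  set e : Module.Basis (Fin 4) ℝ E4 := (EuclideanSpace.basisFun (Fin 4) ℝ).toBasis with he
  obtain ⟨hd0, hd1, hd2⟩ := tendsto_dev_jets_orbit (𝓢 := 𝓢) (Ψ := Ψ) hdev x₀ hdom
  obtain ⟨s₁, hs₁⟩ := eventually_isInvertible_orbit (𝓢 := 𝓢) (Ψ := Ψ) hdev hx₀ hdom
  set S : ℝ := max s₀ s₁ with hS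
  have hSn0 : ∀ n : ℕ, s₀ ≤ S + n := fun n ↦
    (le_max_left s₀ s₁).trans (le_add_of_nonneg_right (Nat.cast_nonneg n))
  have hSn1 : ∀ n : ℕ, s₁ ≤ S + n := fun n ↦
    (le_max_right s₀ s₁).trans (le_add_of_nonneg_right (Nat.cast_nonneg n))
  set xs : ℕ → E4 := fun n ↦ x₀ + (S + n) • v₀ with hxs
  have hΨγ : ∀ n : ℕ, Ψ ⟨xs n, hdom (S + n)⟩ = γ (S + n) := fun n ↦ (hγ (S + n)).symm
  set W : Set E4 := {z : E4 | ∃ h : z ∈ (boostedKerrBackground Λ c M' a').domain,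
    Ψ ⟨z, h⟩ ∈ E ∧ (Gp z).IsInvertible} with hW
  have hxW : ∀ n, xs n ∈ W := fun n ↦
    ⟨hdom (S + n), by rw [hΨγ n]; exact (hs₀ _ (hSn0 n)).1, hs₁ _ (hSn1 n)⟩
  have hWo : IsOpen W := isOpen_goodSet hΨc hGp hEo
  have hGpW : IsMetricOn Gp W := isMetricOn_chartMetric_goodSet hΨc hGp hEo
  have hGBW : IsMetricOn (boostedKerrBilin Λ c M' a') W :=
    isMetricOn_mono (isMetricOn_boostedKerrBilin Λ c M' a') hWo fun z hz ↦ hz.1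
  have hstat : ∀ (n : ℕ) (x : E4), boostedKerrBilin Λ c M' a' (x + (S + (n : ℝ)) • v₀) =
      boostedKerrBilin Λ c M' a' x := fun n x ↦ boostedKerrBilin_add_smul Λ c M' a' x (S + n)
  have h0 : ∀ n, boostedKerrBilin Λ c M' a' (xs n) = boostedKerrBilin Λ c M' a' x₀ := fun n ↦
    hstat n x₀
  have h1 : ∀ n, fderiv ℝ (boostedKerrBilin Λ c M' a') (xs n) =
      fderiv ℝ (boostedKerrBilin Λ c M' a') x₀ := fun n ↦ fderiv_eq_of_forall_add_eq (hstat n) x₀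
  have h2 : ∀ n, fderiv ℝ (fderiv ℝ (boostedKerrBilin Λ c M' a')) (xs n) =
      fderiv ℝ (fderiv ℝ (boostedKerrBilin Λ c M' a')) x₀ := fun n ↦
    fderiv_fderiv_eq_of_forall_add_eq (hstat n) x₀
  have hR : ∀ n (X Y : E4), riemAt (boostedKerrBilin Λ c M' a') (xs n) X Y =
      riemAt (boostedKerrBilin Λ c M' a') x₀ X Y := fun n X Y ↦
    riemAt_eq_of_forall_add_eq (hstat n) x₀ X Y
  have hseq : Tendsto (fun n : ℕ ↦ S + (n : ℝ)) atTop atTop :=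
    tendsto_atTop_add_const_left _ _ tendsto_natCast_atTop_atTop
  have hjet : ∀ n, _ := fun n : ℕ ↦ jets_chartMetric_sub (𝓢 := 𝓢) (Ψ := Ψ) hΨc (hdom (S + n))
  have hd0' : Tendsto (fun n ↦ ‖Gp (xs n) - boostedKerrBilin Λ c M' a' (xs n)‖) atTop (𝓝 0) := by
    refine ((tendsto_zero_iff_norm_tendsto_zero.mp hd0).comp hseq).congr fun n ↦ ?_
    simp only [Function.comp_apply]
    rw [(hjet n).1]
  have hd1' : Tendsto (fun n ↦ ‖fderiv ℝ Gp (xs n) - fderiv ℝ (boostedKerrBilin Λ c M' a') (xs n)‖)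
      atTop (𝓝 0) := by
    refine (hd1.comp hseq).congr fun n ↦ ?_
    simp only [Function.comp_apply]
    rw [(hjet n).2.1]
  have hd2' : Tendsto (fun n ↦ ‖fderiv ℝ (fderiv ℝ Gp) (xs n) -
      fderiv ℝ (fderiv ℝ (boostedKerrBilin Λ c M' a')) (xs n)‖) atTop (𝓝 0) := by
    refine (hd2.comp hseq).congr fun n ↦ ?_
    simp only [Function.comp_apply]
    rw [(hjet n).2.2]
  have HQ := tendsto_quadTrace_of_jets e (fun _ ↦ hGpW) (fun _ ↦ hGBW) hxW h0 h1 h2 hR hd0' hd1' hd2'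
  have HT' := tendsto_cubicTrace_of_jets e (fun _ ↦ hGpW) (fun _ ↦ hGBW) hxW h0 h1 h2 hR hd0' hd1' hd2'
  obtain ⟨tQ, tT⟩ := invariants_at_target Λ c hQ hT hext hr'
  set q : ℕ → E4 := fun n ↦ (χ (γ (S + n))).1 with hq
  have hqn : ∀ n, ((χ (Ψ ⟨xs n, (hxW n).1⟩)).1 : E4) = q n := fun n ↦ by
    simp only [hq]
    rw [hγ (S + n)]
  set Z : ℕ → ℂ := fun n ↦ (M : ℂ) / ((Kerr.radius a (q n) : ℂ) -
    ((a * (q n 3 / Kerr.radius a (q n)) : ℝ) : ℂ) * Complex.I) ^ 3 with hZ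
  have hvals : ∀ n, _ := fun n ↦
    invariants_at_goodSet hΨc hGp hEo hχ (M₀ := M) (hM₀ := hM) hpull hQ hT (hxW n)
  have hsq : Tendsto (fun n ↦ ((Z n) ^ 2).re) atTop
      (𝓝 ((((M' : ℂ) / ((r' : ℂ) - (a' : ℂ) * Complex.I) ^ 3) ^ 2).re)) := by
    have h : Tendsto (fun n ↦ -48 * ((Z n) ^ 2).re) atTop
        (𝓝 (-48 * (((M' : ℂ) / ((r' : ℂ) - (a' : ℂ) * Complex.I) ^ 3) ^ 2).re)) := by
      rw [← tQ]
      refine HQ.congr fun n ↦ ?_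
      have hv := (hvals n).1
      rw [hqn n] at hv
      exact hv
    have h' := h.const_mul ((-48 : ℝ)⁻¹)
    simp only [← mul_assoc, inv_mul_cancel₀ (by norm_num : (-48 : ℝ) ≠ 0), one_mul] at h'
    exact h'
  have hcube : Tendsto (fun n ↦ ((Z n) ^ 3).re) atTop
      (𝓝 ((((M' : ℂ) / ((r' : ℂ) - (a' : ℂ) * Complex.I) ^ 3) ^ 3).re)) := by
    have h : Tendsto (fun n ↦ 48 * ((Z n) ^ 3).re) atTop
        (𝓝 (48 * (((M' : ℂ) / ((r' : ℂ) - (a' : ℂ) * Complex.I) ^ 3) ^ 3).re)) := by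
      rw [← tT]
      refine HT'.congr fun n ↦ ?_
      have hv := (hvals n).2
      rw [hqn n] at hv
      exact hv
    have h' := h.const_mul ((48 : ℝ)⁻¹)
    simp only [← mul_assoc, inv_mul_cancel₀ (by norm_num : (48 : ℝ) ≠ 0), one_mul] at h'
    exact h'
  obtain ⟨harp, hrp⟩ := abs_lt_rPlus ha
  have hrn : ∀ n, Kerr.rPlus M a ≤ Kerr.radius a (q n) := fun n ↦ (hs₀ _ (hSn0 n)).2
  have hrn0 : ∀ n, 0 < Kerr.radius a (q n) := fun n ↦ hrp.trans_le (hrn n)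
  have hbn : ∀ n, |a * (q n 3 / Kerr.radius a (q n))| ≤ |a| := fun n ↦ by
    rw [abs_mul]
    refine mul_le_of_le_one_right (abs_nonneg a) ?_
    rw [abs_div, div_le_one (abs_pos.mpr (hrn0 n).ne'), abs_of_pos (hrn0 n)]
    exact abs_apply_three_le_radius (hrn0 n)
  have hC : ∀ n, ‖Z n‖ ≤ M / Kerr.rPlus M a ^ 3 := fun n ↦ norm_div_cube_le hM hrp (hrn n)
  have hfar1 : ∀ n, ε ≤ ‖Z n - (M' : ℂ) / ((r' : ℂ) - (a' : ℂ) * Complex.I) ^ 3‖ := fun n ↦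
    hsep _ _ (hrn n) (hbn n)
  have hfar2 : ∀ n, ε ≤ ‖Z n - (starRingEnd ℂ) ((M' : ℂ) / ((r' : ℂ) - (a' : ℂ) * Complex.I) ^ 3)‖ :=
    fun n ↦ by
    have h := hsep _ _ (hrn n) (show |-(a * (q n 3 / Kerr.radius a (q n)))| ≤ |a| by
      rw [abs_neg]; exact hbn n)
    rw [← Complex.norm_conj, map_sub, Complex.conj_conj, conj_div_cube]
    exact h
  exact false_of_tendsto_re_sq_re_cube hC hre hε hfar1 hfar2 hsq hcube

end Main

/-- **STUB P** — REGISTERED stub `stub_phaseRigidity` (crux `TameCensorship`, stmt-10047), verbatim. [folklore] -/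
theorem stub_phaseRigidity :
    (∀ (M a : ℝ) (x : E4), 0 < Kerr.radius a x →
      MetricCoord.rmNormSqAt (Kerr.bilin M a) x =
        48 * M ^ 2 * (((Kerr.radius a x : ℂ) +
          ((a * (x 3 / Kerr.radius a x) : ℝ) : ℂ) * Complex.I) ^ 6).re /
          (Kerr.radius a x ^ 2 + (a * (x 3 / Kerr.radius a x)) ^ 2) ^ 6) →
    (∀ (M a : ℝ) (x : E4), 0 < Kerr.radius a x → ∀ (b : Module.Basis (Fin 4) ℝ E4),
      ∑ i, ∑ i', ∑ j, ∑ j', ∑ k, ∑ k',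
        MetricCoord.ginv (Kerr.bilin M a) b x i i' * MetricCoord.ginv (Kerr.bilin M a) b x j j' *
        MetricCoord.ginv (Kerr.bilin M a) b x k k' *
        MetricCoord.traceCLM E4 ((MetricCoord.riemAt (Kerr.bilin M a) x (b i) (b j)).comp
          ((MetricCoord.riemAt (Kerr.bilin M a) x (b j') (b k)).comp
            (MetricCoord.riemAt (Kerr.bilin M a) x (b k') (b i')))) =
        48 * M ^ 3 * (((Kerr.radius a x : ℂ) +
          ((a * (x 3 / Kerr.radius a x) : ℝ) : ℂ) * Complex.I) ^ 9).re /
          (Kerr.radius a x ^ 2 + (a * (x 3 / Kerr.radius a x)) ^ 2) ^ 9) →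
    ∀ [Kerr.Facts] (𝓢 : Spacetime.{0} 4) (M a : ℝ) (hM : 0 ≤ M), |a| < M →
    ∀ (E : Set 𝓢.carrier) (χ : 𝓢.carrier → (Kerr.spacetime M a (Kerr.rMinus M a) hM).carrier),
      IsOpen E → ContMDiffOn (𝓡 4) (𝓡 4) ∞ χ E →
      (∀ p ∈ E, ∀ v w : E4, (Kerr.spacetime M a (Kerr.rMinus M a) hM).metric.val (χ p)
        (mfderiv (𝓡 4) (𝓡 4) χ p v) (mfderiv (𝓡 4) (𝓡 4) χ p w) = 𝓢.metric.val p v w) →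
    ∀ (Λ : lorentzGroup) (c : E4) (M' a' : ℝ), Kerr.IsExtremal M' a' →
    ∀ (τ₀ : ℝ) (Ψ : (boostedKerrBackground Λ c M' a').domain → 𝓢.carrier),
      𝓢.IsLateChart (boostedKerrBackground Λ c M' a') Set.univ τ₀ Ψ →
      (∀ R : ℝ, Tendsto (fun τ => 𝓢.truncDeviationCk
        (boostedKerrBackground Λ c M' a') Ψ 2 R τ) atTop (𝓝 0)) →
      ∃ x₀ : (boostedKerrBackground Λ c M' a').domain,
        (boostedKerrBackground Λ c M' a').bilin x₀.1
            ((Λ : E4 ≃L[ℝ] E4) (EuclideanSpace.single (0 : Fin 4) (1 : ℝ)))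
            ((Λ : E4 ≃L[ℝ] E4) (EuclideanSpace.single (0 : Fin 4) (1 : ℝ))) < 0 ∧
        ∀ (γ : ℝ → 𝓢.carrier)
          (hdom : ∀ s : ℝ, (x₀ : E4) + s • (Λ : E4 ≃L[ℝ] E4) (EuclideanSpace.single (0 : Fin 4) (1 : ℝ)) ∈
            (boostedKerrBackground Λ c M' a').domain),
          (∀ s : ℝ, γ s = Ψ ⟨(x₀ : E4) + s • (Λ : E4 ≃L[ℝ] E4) (EuclideanSpace.single (0 : Fin 4) (1 : ℝ)),
            hdom s⟩) →
          ¬ ∃ s₀ : ℝ, ∀ s : ℝ, s₀ ≤ s →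
              γ s ∈ E ∧ Kerr.rPlus M a ≤ Kerr.radius a (χ (γ s)).1 :=
  fun hQ hT _ 𝓢 M a hM ha E χ hE hχ h5 =>
    stub_phaseRigidity_main hQ hT 𝓢 M a hM ha E χ hE hχ
      (fun p hp => ContinuousLinearMap.ext fun v => ContinuousLinearMap.ext fun w => h5 p hp v w)

end Summit.FinalStateConjecture.FinalStateConjecture.Theorems.PhotonSphereChannels.TameCensorshipCrush
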